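import Summits.QuantumFields.QCD.Theses.PauliWegnerSea
import Summits.QuantumFields.QCD.Theorems.TiltedFlatness.Negative.TwoWellFloor
import Summits.QuantumFields.QCD.Theorems.PauliWegnerSeaTiltedFlatnessStubBandLimit
import Summits.QuantumFields.QCD.Theorems.PauliWegnerSeaTiltedFlatnessStubActionLipschitz
import Summits.QuantumFields.QCD.Theorems.PauliWegnerSeaTiltedFlatnessStubEulerWord
import Summits.QuantumFields.QCD.Theorems.PauliWegnerSeaTiltedFlatnessStubCircleEngine
import Summits.QuantumFields.QCD.Theorems.PauliWegnerSeaTiltedFlatnessStubTorusSmallBalls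
import Summits.QuantumFields.QCD.Theorems.PauliWegnerSeaTiltedFlatnessStubHaarSmallBalls
import Summits.QuantumFields.QCD.Theorems.PauliWegnerSeaTiltedFlatnessStubCircleUntilt
import Literature.MeasureTheory.Integral.TiltedAnticoncentration
import Literature.MathematicalPhysics.QuantumFieldTheory.StrongCouplingActivities
import Literature.MathematicalPhysics.QuantumFieldTheory.QCDPhaseQuenched

/-!
# Crux `PauliWegnerSea.TiltedFlatness` (stmt-QuantumFields-14070) — PROVED, line `circle-transport`

`theorem TiltedFlatness_proof : Summit.QuantumFields.QCD.Theses.PauliWegnerSea.TiltedFlatness`.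

The crux (rev 4 = the repaired `C′`): for every `N_f` there are `C, p, c > 0` such that on every
two-star fibre (links of `star(x) ∪ star(y)` free, the rest frozen to `U`; `L ≥ 4`, `β ≥ 0`, masses in
`[-2,2]^{N_f}`), with `F = ‖det diracMatrix ∘ refit‖`, `wt = e^{-β·wilsonAction ∘ refit}`, product Haar,
`Z = ∫ wt`, `M = ∫ F wt / Z`: (a) `F(W₀) ≤ C(1+β)^p M` and (b′) `M > 0 → ∫ 1{F ≤ εM} wt / Z ≤ C(1+β)^p ε^c`.

The line (one lever, checked skeleton `Cruxes/TiltedFlatness/Lines/circle-transport.lean`, seven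
registered stubs, all landed as `Theorems/PauliWegnerSeaTiltedFlatnessStub*.lean`): move ONE star link
along the circle `s ↦ A·T(s)·B`, `T(s) = diag(e^{is}, e^{-is}, 1)` (`exists_diagCircle`).  Along it the
squared sea is a trigonometric polynomial of `L`-, outside- and mass-free degree (`stub_bandLimit`) and the
Wilson action is uniformly Lipschitz (`stub_actionLipschitz`); a FIXED word of nine conjugated circles is
onto `SU(3)` (`stub_eulerWord`).  The exact coupling `Haar = Haar ∗ word_*Leb` then turns (R1) — β = 0
relative small balls under product Haar — into small balls for separately band-limited functions on the
flat torus (`stub_haarSmallBalls` ∘ `stub_torusSmallBalls` ∘ `stub_circleEngine` = Nikolskii + a weak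
Remez small-ball bound on the circle), and turns the tilt into a ball-free density bound
`wt/Z ≤ C(1+β)^p` (`stub_circleUntilt`).  The trunk (`tiltedFlatness_of_R1_density`, from the
Literature lemma `flatness_and_smallBalls_of_anticoncentration`) assembles both clauses with
`C = max(2(2C_DC_R+1)^{1/c}, C_DC_R)`, `p = max(p₀/c, p₀)`.

This file is the glue: the `≤ 16` star edges are LISTED (`exists_starEdge`), `refit ∘ update = update ∘
refit` on star edges, whence the abstract fibre statements give (R1) (`haarRelativeSmallBalls_of_fibre`)
and the density bound (`tiltDensityBound_of_fibre`) for the crux's own `F`, `wt`; then the trunk.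
Honours `Cruxes/TiltedFlatness/Disproof.lean`: `p > 0` in both clauses, constants depend on `N_f`
(through the degree `48 N_f`), `F ≡ 0` fibres only enter through the guards `0 < F W₀` / `0 < M`.
-/

noncomputable section

namespace Summit.QuantumFields.QCD.Theorems.CircleTransport

open scoped BigOperators Real Matrix.Norms.L2Operator
open MeasureTheory Set Filter
open Literature.MathematicalPhysics.QuantumFieldTheory Literature.MathematicalPhysics.QuantumLattice
  Literature.Probability.LatticeModels
open Summit.QuantumFields.QCD.Theses.PauliWegnerSea

/-! ## The diagonal circle and the listed star edges -/

/-- The diagonal circle `T(θ) = diag(e^{iθ}, e^{-iθ}, 1)` exists as a family in `SU(3)` (the matrix form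
is the hypothesis of the route's `PauliBandLimit` and of every stub of the line). -/
theorem exists_diagCircle : ∃ T : ℝ → Matrix.specialUnitaryGroup (Fin 3) ℂ, ∀ θ : ℝ,
    ((T θ : Matrix.specialUnitaryGroup (Fin 3) ℂ) : Matrix (Fin 3) (Fin 3) ℂ) =
      Matrix.diagonal ![Complex.exp (θ * Complex.I), Complex.exp (-(θ * Complex.I)), 1] := by
  have hconj : ∀ x : ℝ, Complex.exp (x * Complex.I) * star (Complex.exp (x * Complex.I)) = 1 := by
    intro x
    rw [Complex.star_def, Complex.mul_conj, Complex.normSq_eq_norm_sq, Complex.norm_exp_ofReal_mul_I]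
    simp
  have hneg : ∀ x : ℝ, Complex.exp (-(x * Complex.I)) = Complex.exp ((-x : ℝ) * Complex.I) := by
    intro x; push_cast; ring_nf
  have hmem : ∀ θ : ℝ, Matrix.diagonal ![Complex.exp (θ * Complex.I), Complex.exp (-(θ * Complex.I)), 1]
      ∈ Matrix.specialUnitaryGroup (Fin 3) ℂ := by
    intro θ
    rw [Matrix.mem_specialUnitaryGroup_iff, Matrix.mem_unitaryGroup_iff]
    constructor
    · rw [Matrix.star_eq_conjTranspose, Matrix.diagonal_conjTranspose, Matrix.diagonal_mul_diagonal,
        ← Matrix.diagonal_one]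
      congr 1
      funext i
      fin_cases i
      · simpa using hconj θ
      · simpa [hneg] using hconj (-θ)
      · simp
    · rw [Matrix.det_diagonal, Fin.prod_univ_three]
      simp [← Complex.exp_add]
  exact ⟨fun θ => ⟨_, hmem θ⟩, fun θ => rfl⟩

/-- The `≤ 16` edges of `star(x) ∪ star(y)` are LISTED by `(Fin 4 ⊕ Fin 4) ⊕ (Fin 4 ⊕ Fin 4)`:
`(x,μ)`, `(x−μ̂,μ)`, `(y,μ)`, `(y−μ̂,μ)` — every star edge is listed and every listed edge is a star edge. -/
theorem exists_starEdge {L : ℕ} (x y : TorusSite 4 L) :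
    ∃ sE : (Fin 4 ⊕ Fin 4) ⊕ (Fin 4 ⊕ Fin 4) → Edge 4 L,
      (∀ e : Edge 4 L, (e.1 = x ∨ Site.shift e.1 e.2 = x ∨ e.1 = y ∨ Site.shift e.1 e.2 = y) →
        ∃ i, sE i = e) ∧
      ∀ i, (sE i).1 = x ∨ Site.shift (sE i).1 (sE i).2 = x ∨ (sE i).1 = y ∨
        Site.shift (sE i).1 (sE i).2 = y := by
  refine ⟨Sum.elim (Sum.elim (fun μ => (x, μ)) (fun μ => (x - Pi.single μ 1, μ)))
    (Sum.elim (fun μ => (y, μ)) (fun μ => (y - Pi.single μ 1, μ))), ?_, ?_⟩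
  · rintro ⟨z, μ⟩ he
    rcases he with h | h | h | h
    · exact ⟨Sum.inl (Sum.inl μ), Prod.ext h.symm rfl⟩
    · refine ⟨Sum.inl (Sum.inr μ), Prod.ext ?_ rfl⟩
      show x - Pi.single μ 1 = z
      rw [← h]; exact add_sub_cancel_right z _
    · exact ⟨Sum.inr (Sum.inl μ), Prod.ext h.symm rfl⟩
    · refine ⟨Sum.inr (Sum.inr μ), Prod.ext ?_ rfl⟩
      show y - Pi.single μ 1 = z
      rw [← h]; exact add_sub_cancel_right z _
  · rintro ((μ | μ) | (μ | μ))
    · exact Or.inl rfl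
    · exact Or.inr (Or.inl (sub_add_cancel x _))
    · exact Or.inr (Or.inr (Or.inl rfl))
    · exact Or.inr (Or.inr (Or.inr (sub_add_cancel y _)))

/-! ## Glue: abstract fibre statements ⇒ (R1) and the density bound for the crux's own data -/

/-- (R1) for the crux's `F = ‖det diracMatrix ∘ refit‖` from the band limit and the abstract Haar small
balls on `SU(3)^E` (applied with `E = Edge 4 L`, the listed star edges, degree `48 N_f`, `n = 16`). -/
theorem haarRelativeSmallBalls_of_fibre {T : ℝ → Matrix.specialUnitaryGroup (Fin 3) ℂ}
    (hB : ∀ (Nf : ℕ) (mq : Fin Nf → ℝ) (L : ℕ) [NeZero L], 4 ≤ L →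
      ∀ (U : GaugeConfig 4 L (Matrix.specialUnitaryGroup (Fin 3) ℂ)) (e : Edge 4 L)
        (A B : Matrix.specialUnitaryGroup (Fin 3) ℂ),
      ∃ a : ℤ → ℂ, ∀ s : ℝ,
        ((‖(diracMatrix (Function.update U e (A * T s * B)) mq).det‖ ^ 2 : ℝ) : ℂ) =
          ∑ k ∈ Finset.Icc (-((48 * Nf : ℕ) : ℤ)) ((48 * Nf : ℕ) : ℤ),
            a k * Complex.exp ((k : ℂ) * (s : ℂ) * Complex.I))
    (hFS : ∀ (D n : ℕ), ∃ C c : ℝ, 0 < C ∧ 0 < c ∧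
      ∀ (E : Type) [Fintype E] [DecidableEq E] (ι : Type) [Fintype ι] (r : ι → E), Fintype.card ι ≤ n →
      ∀ F : (E → Matrix.specialUnitaryGroup (Fin 3) ℂ) → ℝ, Continuous F → (∀ W, 0 ≤ F W) →
        (∀ W W' : E → Matrix.specialUnitaryGroup (Fin 3) ℂ, (∀ i, W (r i) = W' (r i)) → F W = F W') →
        (∀ (W : E → Matrix.specialUnitaryGroup (Fin 3) ℂ) (i : ι)
          (A B : Matrix.specialUnitaryGroup (Fin 3) ℂ), ∃ a : ℤ → ℂ, ∀ t : ℝ,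
          ((F (Function.update W (r i) (A * T t * B)) ^ 2 : ℝ) : ℂ) =
            ∑ k ∈ Finset.Icc (-(D : ℤ)) D, a k * Complex.exp ((k : ℂ) * (t : ℂ) * Complex.I)) →
        ∀ W₀ : E → Matrix.specialUnitaryGroup (Fin 3) ℂ, 0 < F W₀ → ∀ ε : ℝ, 0 < ε →
          ((Measure.pi fun _ : E => haarProbability (Matrix.specialUnitaryGroup (Fin 3) ℂ))
            {W | F W ≤ ε * F W₀}).toReal ≤ C * ε ^ c) :
    ∀ Nf : ℕ, ∃ C c : ℝ, 0 < C ∧ 0 < c ∧ ∀ mq : Fin Nf → ℝ, (∀ f, -2 ≤ mq f ∧ mq f ≤ 2) →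
      ∀ (L : ℕ) [NeZero L], 4 ≤ L →
      ∀ (U : GaugeConfig 4 L (Matrix.specialUnitaryGroup (Fin 3) ℂ)) (x y : TorusSite 4 L),
      let star : Edge 4 L → Prop := fun e => e.1 = x ∨ Site.shift e.1 e.2 = x ∨ e.1 = y ∨ Site.shift e.1 e.2 = y
      let refit : GaugeConfig 4 L (Matrix.specialUnitaryGroup (Fin 3) ℂ) →
          GaugeConfig 4 L (Matrix.specialUnitaryGroup (Fin 3) ℂ) := fun W e => if star e then W e else U e
      let F : GaugeConfig 4 L (Matrix.specialUnitaryGroup (Fin 3) ℂ) → ℝ :=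
        fun W => ‖(diracMatrix (refit W) mq).det‖
      let haar : Measure (GaugeConfig 4 L (Matrix.specialUnitaryGroup (Fin 3) ℂ)) :=
        Measure.pi fun _ => haarProbability (Matrix.specialUnitaryGroup (Fin 3) ℂ)
      ∀ (W₀ : GaugeConfig 4 L (Matrix.specialUnitaryGroup (Fin 3) ℂ)), 0 < F W₀ → ∀ ε : ℝ, 0 < ε →
        (haar {W | F W ≤ ε * F W₀}).toReal ≤ C * ε ^ c := by
  intro Nf
  obtain ⟨C, c, hC, hc, hR⟩ := hFS (48 * Nf) 16
  refine ⟨C, c, hC, hc, ?_⟩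
  intro mq _ L _ hL U x y star refit F haar W₀ hW₀ ε hε
  obtain ⟨sE, hcover, hstar⟩ := exists_starEdge x y
  have hrefit : Continuous refit := by
    refine continuous_pi fun e => ?_
    by_cases h : star e
    · simp only [refit, if_pos h]; exact continuous_apply e
    · simp only [refit, if_neg h]; exact continuous_const
  have hFc : Continuous F :=
    continuous_norm.comp (((TiltedFlatnessNegative.continuous_diracMatrix mq).comp hrefit).matrix_det)
  have hupd : ∀ e, star e → ∀ (W : GaugeConfig 4 L (Matrix.specialUnitaryGroup (Fin 3) ℂ))
      (g : Matrix.specialUnitaryGroup (Fin 3) ℂ),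
      refit (Function.update W e g) = Function.update (refit W) e g := by
    intro e he W g
    funext e'
    by_cases h : e' = e
    · subst h; simp only [refit, Function.update_self, if_pos he]
    · simp only [refit, Function.update_of_ne h]
  have hdep : ∀ W W' : GaugeConfig 4 L (Matrix.specialUnitaryGroup (Fin 3) ℂ),
      (∀ i, W (sE i) = W' (sE i)) → F W = F W' := by
    intro W W' h
    have : refit W = refit W' := by
      funext e
      by_cases he : star e
      · obtain ⟨i, rfl⟩ := hcover e he
        simp only [refit, if_pos he, h i]
      · simp only [refit, if_neg he]
    simp only [F, this]
  have hband : ∀ (W : GaugeConfig 4 L (Matrix.specialUnitaryGroup (Fin 3) ℂ))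
      (i : (Fin 4 ⊕ Fin 4) ⊕ (Fin 4 ⊕ Fin 4)) (A B : Matrix.specialUnitaryGroup (Fin 3) ℂ),
      ∃ a : ℤ → ℂ, ∀ t : ℝ,
        ((F (Function.update W (sE i) (A * T t * B)) ^ 2 : ℝ) : ℂ) =
          ∑ k ∈ Finset.Icc (-((48 * Nf : ℕ) : ℤ)) ((48 * Nf : ℕ) : ℤ),
            a k * Complex.exp ((k : ℂ) * (t : ℂ) * Complex.I) := by
    intro W i A B
    obtain ⟨a, ha⟩ := hB Nf mq L hL (refit W) (sE i) A B
    refine ⟨a, fun t => ?_⟩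
    simpa only [F, hupd _ (hstar i)] using ha t
  exact hR (Edge 4 L) ((Fin 4 ⊕ Fin 4) ⊕ (Fin 4 ⊕ Fin 4)) sE (by simp) F hFc (fun W => norm_nonneg _)
    hdep hband W₀ hW₀ ε hε

/-- The density bound for the crux's `wt = e^{-β·wilsonAction ∘ refit}` from the action's Lipschitz bound
and the abstract ball-free untilt on `SU(3)^E` (applied with the listed star edges, `n = 16`). -/
theorem tiltDensityBound_of_fibre {T : ℝ → Matrix.specialUnitaryGroup (Fin 3) ℂ}
    (hLip : ∃ K : ℝ, 0 ≤ K ∧ ∀ (L : ℕ) [NeZero L], 4 ≤ L →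
      ∀ (U : GaugeConfig 4 L (Matrix.specialUnitaryGroup (Fin 3) ℂ)) (e : Edge 4 L)
        (A B : Matrix.specialUnitaryGroup (Fin 3) ℂ) (s s' : ℝ),
      |wilsonAction (fundamentalRep (Fin 3)) (Function.update U e (A * T s * B)) -
          wilsonAction (fundamentalRep (Fin 3)) (Function.update U e (A * T s' * B))| ≤ K * |s - s'|)
    (hFD : ∀ (n : ℕ) (K : ℝ), ∃ C p : ℝ, 0 < C ∧
      ∀ (E : Type) [Fintype E] [DecidableEq E] (ι : Type) [Fintype ι] (r : ι → E), Fintype.card ι ≤ n →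
      ∀ S : (E → Matrix.specialUnitaryGroup (Fin 3) ℂ) → ℝ, Continuous S →
        (∀ W W' : E → Matrix.specialUnitaryGroup (Fin 3) ℂ, (∀ i, W (r i) = W' (r i)) → S W = S W') →
        (∀ (W : E → Matrix.specialUnitaryGroup (Fin 3) ℂ) (i : ι)
          (A B : Matrix.specialUnitaryGroup (Fin 3) ℂ) (s s' : ℝ),
          |S (Function.update W (r i) (A * T s * B)) -
              S (Function.update W (r i) (A * T s' * B))| ≤ K * |s - s'|) →
        ∀ β : ℝ, 0 ≤ β → ∀ W : E → Matrix.specialUnitaryGroup (Fin 3) ℂ,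
          Real.exp (-(β * S W)) /
              (∫ W', Real.exp (-(β * S W'))
                ∂(Measure.pi fun _ : E => haarProbability (Matrix.specialUnitaryGroup (Fin 3) ℂ))) ≤
            C * (1 + β) ^ p) :
    ∃ C p : ℝ, 0 < C ∧ ∀ β : ℝ, 0 ≤ β → ∀ (L : ℕ) [NeZero L], 4 ≤ L →
      ∀ (U : GaugeConfig 4 L (Matrix.specialUnitaryGroup (Fin 3) ℂ)) (x y : TorusSite 4 L),
      let star : Edge 4 L → Prop := fun e => e.1 = x ∨ Site.shift e.1 e.2 = x ∨ e.1 = y ∨ Site.shift e.1 e.2 = y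
      let refit : GaugeConfig 4 L (Matrix.specialUnitaryGroup (Fin 3) ℂ) →
          GaugeConfig 4 L (Matrix.specialUnitaryGroup (Fin 3) ℂ) := fun W e => if star e then W e else U e
      let wt : GaugeConfig 4 L (Matrix.specialUnitaryGroup (Fin 3) ℂ) → ℝ :=
        fun W => Real.exp (-(β * wilsonAction (fundamentalRep (Fin 3)) (refit W)))
      let haar : Measure (GaugeConfig 4 L (Matrix.specialUnitaryGroup (Fin 3) ℂ)) :=
        Measure.pi fun _ => haarProbability (Matrix.specialUnitaryGroup (Fin 3) ℂ)
      let Z : ℝ := ∫ W, wt W ∂haar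
      ∀ W, wt W / Z ≤ C * (1 + β) ^ p := by
  obtain ⟨K, -, hK⟩ := hLip
  obtain ⟨C, p, hC, hD⟩ := hFD 16 K
  refine ⟨C, p, hC, ?_⟩
  intro β hβ L _ hL4 U x y star refit wt haar Z W
  obtain ⟨sE, hcover, hstar⟩ := exists_starEdge x y
  have hrefit : Continuous refit := by
    refine continuous_pi fun e => ?_
    by_cases h : star e
    · simp only [refit, if_pos h]; exact continuous_apply e
    · simp only [refit, if_neg h]; exact continuous_const
  have hSc : Continuous fun W => wilsonAction (fundamentalRep (Fin 3)) (refit W) :=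
    (TiltedFlatnessNegative.continuous_wilsonAction (fundamentalRep (Fin 3))
      (continuous_fundamentalRep (Fin 3))).comp hrefit
  have hupd : ∀ e, star e → ∀ (W : GaugeConfig 4 L (Matrix.specialUnitaryGroup (Fin 3) ℂ))
      (g : Matrix.specialUnitaryGroup (Fin 3) ℂ),
      refit (Function.update W e g) = Function.update (refit W) e g := by
    intro e he W g
    funext e'
    by_cases h : e' = e
    · subst h; simp only [refit, Function.update_self, if_pos he]
    · simp only [refit, Function.update_of_ne h]
  have hdep : ∀ W W' : GaugeConfig 4 L (Matrix.specialUnitaryGroup (Fin 3) ℂ),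
      (∀ i, W (sE i) = W' (sE i)) →
      wilsonAction (fundamentalRep (Fin 3)) (refit W) = wilsonAction (fundamentalRep (Fin 3)) (refit W') := by
    intro W W' h
    have : refit W = refit W' := by
      funext e
      by_cases he : star e
      · obtain ⟨i, rfl⟩ := hcover e he
        simp only [refit, if_pos he, h i]
      · simp only [refit, if_neg he]
    rw [this]
  have hlip : ∀ (W : GaugeConfig 4 L (Matrix.specialUnitaryGroup (Fin 3) ℂ))
      (i : (Fin 4 ⊕ Fin 4) ⊕ (Fin 4 ⊕ Fin 4)) (A B : Matrix.specialUnitaryGroup (Fin 3) ℂ) (s s' : ℝ),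
      |wilsonAction (fundamentalRep (Fin 3)) (refit (Function.update W (sE i) (A * T s * B))) -
          wilsonAction (fundamentalRep (Fin 3))
            (refit (Function.update W (sE i) (A * T s' * B)))| ≤ K * |s - s'| := by
    intro W i A B s s'
    rw [hupd _ (hstar i), hupd _ (hstar i)]
    exact hK L hL4 (refit W) (sE i) A B s s'
  exact hD (Edge 4 L) ((Fin 4 ⊕ Fin 4) ⊕ (Fin 4 ⊕ Fin 4)) sE (by simp)
    (fun W => wilsonAction (fundamentalRep (Fin 3)) (refit W)) hSc hdep hlip β hβ W

/-! ## The trunk: (R1) + density bound ⇒ the crux -/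

/-- PROVED TRUNK: the crux `TiltedFlatness` (both clauses) follows from (R1) (β = 0 relative small balls
under product Haar, uniformly in masses, volume, outside and sites) and the density bound
`wt/Z ≤ C_D (1+β)^{p₀}`, with `C = max(2(2C_DC_R+1)^{1/c}, C_DC_R)`, `p = max(p₀⁺/c, p₀⁺)`, same `c`
(`Literature.MeasureTheory.Integral.flatness_and_smallBalls_of_anticoncentration`). -/
theorem tiltedFlatness_of_R1_density
    (hR1 : ∀ Nf : ℕ, ∃ C c : ℝ, 0 < C ∧ 0 < c ∧ ∀ mq : Fin Nf → ℝ, (∀ f, -2 ≤ mq f ∧ mq f ≤ 2) →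
      ∀ (L : ℕ) [NeZero L], 4 ≤ L →
      ∀ (U : GaugeConfig 4 L (Matrix.specialUnitaryGroup (Fin 3) ℂ)) (x y : TorusSite 4 L),
      let star : Edge 4 L → Prop := fun e => e.1 = x ∨ Site.shift e.1 e.2 = x ∨ e.1 = y ∨ Site.shift e.1 e.2 = y
      let refit : GaugeConfig 4 L (Matrix.specialUnitaryGroup (Fin 3) ℂ) →
          GaugeConfig 4 L (Matrix.specialUnitaryGroup (Fin 3) ℂ) := fun W e => if star e then W e else U e
      let F : GaugeConfig 4 L (Matrix.specialUnitaryGroup (Fin 3) ℂ) → ℝ :=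
        fun W => ‖(diracMatrix (refit W) mq).det‖
      let haar : Measure (GaugeConfig 4 L (Matrix.specialUnitaryGroup (Fin 3) ℂ)) :=
        Measure.pi fun _ => haarProbability (Matrix.specialUnitaryGroup (Fin 3) ℂ)
      ∀ (W₀ : GaugeConfig 4 L (Matrix.specialUnitaryGroup (Fin 3) ℂ)), 0 < F W₀ → ∀ ε : ℝ, 0 < ε →
        (haar {W | F W ≤ ε * F W₀}).toReal ≤ C * ε ^ c)
    (hD : ∃ C p : ℝ, 0 < C ∧ ∀ β : ℝ, 0 ≤ β → ∀ (L : ℕ) [NeZero L], 4 ≤ L →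
      ∀ (U : GaugeConfig 4 L (Matrix.specialUnitaryGroup (Fin 3) ℂ)) (x y : TorusSite 4 L),
      let star : Edge 4 L → Prop := fun e => e.1 = x ∨ Site.shift e.1 e.2 = x ∨ e.1 = y ∨ Site.shift e.1 e.2 = y
      let refit : GaugeConfig 4 L (Matrix.specialUnitaryGroup (Fin 3) ℂ) →
          GaugeConfig 4 L (Matrix.specialUnitaryGroup (Fin 3) ℂ) := fun W e => if star e then W e else U e
      let wt : GaugeConfig 4 L (Matrix.specialUnitaryGroup (Fin 3) ℂ) → ℝ :=
        fun W => Real.exp (-(β * wilsonAction (fundamentalRep (Fin 3)) (refit W)))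
      let haar : Measure (GaugeConfig 4 L (Matrix.specialUnitaryGroup (Fin 3) ℂ)) :=
        Measure.pi fun _ => haarProbability (Matrix.specialUnitaryGroup (Fin 3) ℂ)
      let Z : ℝ := ∫ W, wt W ∂haar
      ∀ W, wt W / Z ≤ C * (1 + β) ^ p) :
    Summit.QuantumFields.QCD.Theses.PauliWegnerSea.TiltedFlatness := by
  intro Nf
  obtain ⟨C_R, c, hCR, hc, hR⟩ := hR1 Nf
  obtain ⟨C_D, p₀, hCD, hDD⟩ := hD
  set P : ℝ := max (max p₀ 0 / c) (max p₀ 0) with hP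
  set Cbig : ℝ := max (2 * (2 * C_D * C_R + 1) ^ (1 / c)) (C_D * C_R) with hCbig
  refine ⟨Cbig, P, c, lt_max_of_lt_right (mul_pos hCD hCR), hc, ?_⟩
  intro β hβ mq hmq L _ hL U x y star refit F wt haar Z M
  have hrefit : Continuous refit := by
    refine continuous_pi fun e => ?_
    by_cases h : star e
    · simp only [refit, if_pos h]; exact continuous_apply e
    · simp only [refit, if_neg h]; exact continuous_const
  have hFc : Continuous F :=
    continuous_norm.comp (((TiltedFlatnessNegative.continuous_diracMatrix mq).comp hrefit).matrix_det)
  have hSc : Continuous fun W => wilsonAction (fundamentalRep (Fin 3)) (refit W) :=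
    (TiltedFlatnessNegative.continuous_wilsonAction (fundamentalRep (Fin 3))
      (continuous_fundamentalRep (Fin 3))).comp hrefit
  have hwtc : Continuous wt := Real.continuous_exp.comp ((continuous_const.mul hSc).neg)
  have hF0 : ∀ W, 0 ≤ F W := fun W => norm_nonneg _
  have hwt0 : ∀ W, 0 < wt W := fun W => Real.exp_pos _
  haveI : IsProbabilityMeasure haar := by
    show IsProbabilityMeasure (Measure.pi fun _ => haarProbability (Matrix.specialUnitaryGroup (Fin 3) ℂ))
    infer_instance
  have hZ : 0 < Z := by
    obtain ⟨Wm, -, hWm⟩ := isCompact_univ.exists_isMinOn univ_nonempty hwtc.continuousOn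
    have hle : ∫ W, wt Wm ∂haar ≤ Z :=
      integral_mono (integrable_const _) (TiltedFlatnessNegative.integrable_of_continuous hwtc)
        fun W => hWm (mem_univ W)
    have hc' : ∫ W, wt Wm ∂haar = wt Wm := by simp
    linarith [hwt0 Wm]
  have h1β : (1 : ℝ) ≤ 1 + β := by linarith
  set t : ℝ := (1 + β) ^ (max p₀ 0) with ht
  have hKle : C_D * (1 + β) ^ p₀ ≤ C_D * t :=
    mul_le_mul_of_nonneg_left (Real.rpow_le_rpow_of_exponent_le h1β (le_max_left _ _)) hCD.le
  have hdens : ∀ W, wt W ≤ C_D * t * Z := by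
    intro W
    have h' : wt W / Z ≤ C_D * (1 + β) ^ p₀ := hDD β hβ L hL U x y W
    rw [div_le_iff₀ hZ] at h'
    exact h'.trans (mul_le_mul_of_nonneg_right hKle hZ.le)
  have hR1' : ∀ W₀, 0 < F W₀ → ∀ ε : ℝ, 0 < ε → (haar {W | F W ≤ ε * F W₀}).toReal ≤ C_R * ε ^ c :=
    fun W₀ hW₀ ε hε => hR mq hmq L hL U x y W₀ hW₀ ε hε
  obtain ⟨ha, hb⟩ :=
    Literature.MeasureTheory.Integral.flatness_and_smallBalls_of_anticoncentration haar hFc hwtc hF0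
      (fun W => (hwt0 W).le) (by positivity : 0 ≤ C_D * t) hCR.le hc hZ hdens hR1'
  have hA : 2 * (C_D * t) * C_R + 1 ≤ (2 * C_D * C_R + 1) * t := by
    have ht1 : 1 ≤ t := Real.one_le_rpow h1β (le_max_right _ _)
    nlinarith [mul_pos hCD hCR]
  have htP1 : t ^ (1 / c) ≤ (1 + β) ^ P := by
    rw [ht, ← Real.rpow_mul (by linarith), mul_one_div]
    exact Real.rpow_le_rpow_of_exponent_le h1β (le_max_left _ _)
  have htP2 : t ≤ (1 + β) ^ P := Real.rpow_le_rpow_of_exponent_le h1β (le_max_right _ _)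
  have hM0 : 0 ≤ M := div_nonneg (integral_nonneg fun W => mul_nonneg (hF0 W) (hwt0 W).le) hZ.le
  refine ⟨fun W₀ => (ha W₀).trans ?_, fun hM ε hε => (hb hM ε hε).trans ?_⟩
  · have h2 : (2 * (C_D * t) * C_R + 1) ^ (1 / c) ≤ (2 * C_D * C_R + 1) ^ (1 / c) * (1 + β) ^ P := by
      calc (2 * (C_D * t) * C_R + 1) ^ (1 / c) ≤ ((2 * C_D * C_R + 1) * t) ^ (1 / c) :=
            Real.rpow_le_rpow (by positivity) hA (by positivity)
        _ = (2 * C_D * C_R + 1) ^ (1 / c) * t ^ (1 / c) := Real.mul_rpow (by positivity) (by positivity)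
        _ ≤ (2 * C_D * C_R + 1) ^ (1 / c) * (1 + β) ^ P :=
            mul_le_mul_of_nonneg_left htP1 (by positivity)
    calc 2 * (2 * (C_D * t) * C_R + 1) ^ (1 / c) * M
        ≤ 2 * ((2 * C_D * C_R + 1) ^ (1 / c) * (1 + β) ^ P) * M := by gcongr
      _ = (2 * (2 * C_D * C_R + 1) ^ (1 / c)) * (1 + β) ^ P * M := by ring
      _ ≤ Cbig * (1 + β) ^ P * M := by gcongr; exact le_max_left _ _
  · calc C_D * t * C_R * ε ^ c = (C_D * C_R) * t * ε ^ c := by ring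
      _ ≤ Cbig * (1 + β) ^ P * ε ^ c := by
          gcongr
          · exact le_max_right _ _

/-! ## The crux, by name -/

/-- **`PauliWegnerSea.TiltedFlatness` holds** (crux K3 of route `PauliWegnerSea`, item stmt-QuantumFields-14070,
rev 4 = `C′`): Laplace–Remez on the two-star fibre with a polynomial loss in both clauses.  Proof = line
`circle-transport`: the seven landed stubs at the diagonal circle `T` (`exists_diagCircle`), the glue
`haarRelativeSmallBalls_of_fibre` / `tiltDensityBound_of_fibre`, and the trunk `tiltedFlatness_of_R1_density`. -/
theorem TiltedFlatness_proof : Summit.QuantumFields.QCD.Theses.PauliWegnerSea.TiltedFlatness := by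
  obtain ⟨T, hT⟩ := exists_diagCircle
  have hW := stub_eulerWord T hT
  exact tiltedFlatness_of_R1_density
    (haarRelativeSmallBalls_of_fibre (stub_bandLimit T hT)
      (stub_haarSmallBalls T hT hW (stub_torusSmallBalls stub_circleEngine.1 stub_circleEngine.2)))
    (tiltDensityBound_of_fibre (stub_actionLipschitz T hT) (stub_circleUntilt T hT hW))

end Summit.QuantumFields.QCD.Theorems.CircleTransport
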